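import Summits.ResolutionOfSingularities.ResolutionOfSingularities.Theorems.HilbertSamuelEliminationCampaignW42ReesPolyMap
import Summits.ResolutionOfSingularities.ResolutionOfSingularities.Theorems.HilbertSamuelEliminationCampaignW42ConeHilbertSamuel
import Literature.AlgebraicGeometry.Resolution.BlowupFibreConeModel
import Literature.RingTheory.HilbertSamuel.PhiLowerBound
import HarnessLib

/-!
# [OURS · L1 W4.2] The polynomial presentation `k[Y_1, …, Y_n] ↠ gr_𝔭(𝒪) ⊗ k` of the fibre cone of a centre
# `𝔭 = (c_1, …, c_n)`: the homogeneous ideal `I(c)` of `C_{X,D,x} ⊆ N_x = 𝔸ⁿ_k`, and `H⁽⁰⁾(𝒪_{C,0}) = H(k[Y]/I(c))`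
# (campaign s42, cell res-hironaka; informal crux `RidgeConfinement`, stmt-ResolutionOfSingularities-17845; `--supports`)

HONEST FRAMING. OURS (slot W4.2, prover res-L1-s42-pv-1, gen 3): the dictionary between the tree's INTRINSIC fibre cone
`FibreCone 𝔭 = 𝒪[𝔭t]/𝔫𝒪[𝔭t] = ⊕_m 𝔭ᵐ/𝔫𝔭ᵐ` of a local ring `(𝒪, 𝔫, k)` along `𝔭 = (c_1, …, c_n)` (`FibreCone.lean`;
`C_{X,D,x} = Spec(gr_𝔭 𝒪_{X,x} ⊗ k(x))`, CJS p. 46) and the COORDINATE cones `V(I) ⊆ 𝔸ⁿ_k` of homogeneous ideals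
`I ⊆ k[Y_1, …, Y_n]` on which gens 0–2 of this campaign proved the cone theorems (`…RidgeConeNear`, `…ConeRidgeClosedPoint`,
`…ConeSemicontinuity`): the generators `c` present the fibre cone as a quotient of the polynomial ring,
`Y_l ↦ c_l t mod 𝔫` (the substitution `reesPolyMap` of `…CampaignW42ReesPolyMap.lean` reduced modulo `𝔫`).

* `CampaignW42.fibreConePolyMap c : k[Y] → FibreCone 𝔭` (`Y_l ↦ c_l t mod 𝔫`) and **`CampaignW42.fibreConeIdeal c`**, its
  kernel — THE HOMOGENEOUS IDEAL OF THE CONE `C_{X,D,x} ⊆ N_x` in the coordinates `Y_l ↔ c̄_l` of `N_x = (𝔭/𝔫𝔭)^∨`;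
* `fibreConePolyMap_map_residue` (compatibility with `reesPolyMap`), `map_residue_mem_fibreConeIdeal_iff` (a form `g` of
  degree `m` lies in `I(c)` iff a homogeneous lift `G` has `G(c) ∈ 𝔫𝔭ᵐ`);
* `fibreConePolyMap_surjective`, `isHomogeneousIdeal_fibreConeIdeal`, `comap_fibreConePolyMap_fibreConeVertex`
  (the vertex pulls back to `(Y_1, …, Y_n) = ker(eval 0)`), `fibreConeIdeal_le_ker_eval_zero`;
* `CampaignW42.fibreConeQuotEquiv c : k[Y]/I(c) ≃+* FibreCone 𝔭` and **`hilbertFun_fibreConeLocal_eq_hilbertFunQuot`**: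
  `H⁽⁰⁾(FibreConeLocal 𝔭) = H(k[Y]/I(c))` (`hilbertFunQuot`), so that the chain of
  `PermissibleBlowupHilbertSamuelLocal.lean` / `…CampaignW42PermissibleNearEqualities.lean` can be read on `V(I(c))`.

No minimality of `c` is assumed (redundant generators give linear forms in `I(c)`). NOTHING here is a statement of
H. Hironaka's manuscript [Hironaka2017]. AI review is weaker than expert review.
References (orientation only): V. Cossart, U. Jannsen, S. Saito, LNM 2270 (2020), proof of Thm. 3.10 (p. 46);
M. Herrmann, S. Ikeda, U. Orbanz (1988), (31.1).
-/

noncomputable section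

-- single-conjunct summit: the doubled namespace component `ResolutionOfSingularities` is mandated
set_option linter.dupNamespace false

open IsLocalRing MvPolynomial
open Literature.RingTheory.HilbertSamuel
open Literature.AlgebraicGeometry.Resolution

namespace Summit.ResolutionOfSingularities.ResolutionOfSingularities.Theorems

namespace CampaignW42

universe u

/-! ## The fibre cone as a quotient of `k[Y_1, …, Y_n]` -/

section Cone

variable {O : Type u} [CommRing O] [IsLocalRing O] {n : ℕ} (c : Fin n → O)

local notation3 "𝔭" => Ideal.span (Set.range c)

/-- [OURS · L1 W4.2] **The presentation `k[Y_1, …, Y_n] → gr_𝔭(𝒪) ⊗ k = FibreCone 𝔭`, `Y_l ↦ c_l t mod 𝔫`** (constants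
through `k → FibreCone 𝔭`, `fibreConeResidueMap`). NOT a statement of the manuscript. [folklore] -/
def fibreConePolyMap : MvPolynomial (Fin n) (ResidueField O) →+* FibreCone (𝔭) :=
  eval₂Hom (fibreConeResidueMap (𝔭)) fun l => Ideal.Quotient.mk (reesMaxExt (𝔭)) (reesGen c l)

/-- [OURS · L1 W4.2] **The homogeneous ideal `I(c) ⊆ k[Y_1, …, Y_n]` of the fibre cone `C_{X,D,x} ⊆ N_x`** in the
coordinates dual to `c̄_1, …, c̄_n`: the kernel of `fibreConePolyMap c`. NOT a statement of the manuscript. [folklore] -/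
def fibreConeIdeal : Ideal (MvPolynomial (Fin n) (ResidueField O)) := RingHom.ker (fibreConePolyMap c)

/-- `Y_l ↦ c_l t mod 𝔫`. [folklore] -/
@[simp] theorem fibreConePolyMap_X (l : Fin n) :
    fibreConePolyMap c (X l) = Ideal.Quotient.mk (reesMaxExt (𝔭)) (reesGen c l) :=
  eval₂Hom_X' _ _ l

/-- Constants: `a ↦ a` through `k → FibreCone 𝔭`. [folklore] -/
@[simp] theorem fibreConePolyMap_C (a : ResidueField O) :
    fibreConePolyMap c (C a) = fibreConeResidueMap (𝔭) a :=
  eval₂Hom_C _ _ a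

/-- **Compatibility with the lift `𝒪[Y] → 𝒪[𝔭t]`**: `Ḡ ↦ G(c t) mod 𝔫`. [folklore] -/
theorem fibreConePolyMap_map_residue (G : MvPolynomial (Fin n) O) :
    fibreConePolyMap c (MvPolynomial.map (residue O) G) =
      Ideal.Quotient.mk (reesMaxExt (𝔭)) (reesPolyMap c G) := by
  rw [fibreConePolyMap, eval₂Hom_map_hom, reesPolyMap, map_eval₂Hom]
  have hcomp : (fibreConeResidueMap (𝔭)).comp (residue O) =
      (Ideal.Quotient.mk (reesMaxExt (𝔭))).comp (algebraMap O (ReesRing (𝔭))) :=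
    RingHom.ext fun r => fibreConeResidueMap_residue (𝔭) r
  rw [hcomp]

/-- **`fibreConePolyMap c` is surjective** (`𝒪[𝔭t]` is generated by the `c_l t`). [folklore] -/
theorem fibreConePolyMap_surjective : Function.Surjective (fibreConePolyMap c) := by
  intro y
  obtain ⟨b, rfl⟩ := Ideal.Quotient.mk_surjective y
  -- `b = Σ_m b_m tᵐ`, and `b_m ∈ 𝔭ᵐ` is a form of degree `m` in the `c_l`
  have key : ∀ (m : ℕ) (x : O) (hx : x ∈ (𝔭) ^ m), ∃ G : MvPolynomial (Fin n) O, G.IsHomogeneous m ∧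
      reesPolyMap c G = ReesRing.tMonomial (𝔭) m x hx := by
    intro m
    induction m with
    | zero =>
      intro x hx
      refine ⟨C x, isHomogeneous_C _ _, ReesRing.ext (𝔭) ?_⟩
      rw [poly_reesPolyMap_of_isHomogeneous c (isHomogeneous_C _ x), eval_C, ReesRing.poly_tMonomial]
    | succ m ih =>
      have step : ∀ y, y ∈ (𝔭) ^ m * (𝔭) → ∃ hy : y ∈ (𝔭) ^ (m + 1), ∃ G : MvPolynomial (Fin n) O,
          G.IsHomogeneous (m + 1) ∧ reesPolyMap c G = ReesRing.tMonomial (𝔭) (m + 1) y hy := by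
        intro y hy
        refine Submodule.mul_induction_on hy ?_ ?_
        · intro a ha z hz
          have haz : a * z ∈ (𝔭) ^ (m + 1) := by rw [pow_succ]; exact Ideal.mul_mem_mul ha hz
          obtain ⟨Ga, hGa, hGa'⟩ := ih a ha
          obtain ⟨e, rfl⟩ := Ideal.mem_span_range_iff_exists_fun.mp hz
          refine ⟨haz, Ga * ∑ i, C (e i) * X i, ?_, ReesRing.ext (𝔭) ?_⟩
          · refine hGa.mul (IsHomogeneous.sum _ _ _ fun i _ => ?_)
            simpa using (isHomogeneous_C (Fin n) (e i)).mul (isHomogeneous_X _ i)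
          · have hlin : (∑ i, C (e i) * X i : MvPolynomial (Fin n) O).IsHomogeneous 1 :=
              IsHomogeneous.sum _ _ _ fun i _ => by
                simpa using (isHomogeneous_C (Fin n) (e i)).mul (isHomogeneous_X _ i)
            have hevGa : eval c Ga = a := by
              have h := congrArg (fun b => (ReesRing.poly (𝔭) b).coeff m) hGa'
              simpa only [poly_reesPolyMap_of_isHomogeneous c hGa, ReesRing.poly_tMonomial,
                Polynomial.coeff_monomial, if_true] using h
            rw [poly_reesPolyMap_of_isHomogeneous c (hGa.mul hlin), ReesRing.poly_tMonomial, map_mul, hevGa]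
            congr 1
            simp [map_sum, eval_X]
        · rintro a z ⟨ha, Ga, hGa, hGa'⟩ ⟨hz, Gz, hGz, hGz'⟩
          refine ⟨add_mem ha hz, Ga + Gz, hGa.add hGz, ?_⟩
          rw [map_add, hGa', hGz', ReesRing.tMonomial_add]
      intro x hx
      have hx' : x ∈ (𝔭) ^ m * (𝔭) := by rwa [← pow_succ]
      obtain ⟨_, G, hG, hG'⟩ := step x hx'
      exact ⟨G, hG, hG'⟩
  have hb : ∃ G : MvPolynomial (Fin n) O, reesPolyMap c G = b := by
    rw [← ReesRing.sum_tMonomial_coeff (𝔭) b]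
    refine Finset.induction_on (ReesRing.poly (𝔭) b).support ⟨0, by rw [map_zero, Finset.sum_empty]⟩ ?_
    intro m s hm ⟨G, hG⟩
    obtain ⟨Gm, -, hGm⟩ := key m _ (ReesRing.coeff_poly_mem (𝔭) b m)
    exact ⟨Gm + G, by rw [map_add, hGm, hG, Finset.sum_insert hm]⟩
  obtain ⟨G, hG⟩ := hb
  exact ⟨MvPolynomial.map (residue O) G, by rw [fibreConePolyMap_map_residue, hG]⟩

/-- **A form `g` of degree `m` over `k` lies in `I(c)` iff `G(c) ∈ 𝔫𝔭ᵐ` for a (any) homogeneous lift `G`.**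
[folklore] -/
theorem map_residue_mem_fibreConeIdeal_iff {G : MvPolynomial (Fin n) O} {m : ℕ} (hG : G.IsHomogeneous m) :
    MvPolynomial.map (residue O) G ∈ fibreConeIdeal c ↔ eval c G ∈ maximalIdeal O * (𝔭) ^ m := by
  rw [fibreConeIdeal, RingHom.mem_ker, fibreConePolyMap_map_residue, Ideal.Quotient.eq_zero_iff_mem,
    mem_reesMaxExt_iff_coeff, poly_reesPolyMap_of_isHomogeneous c hG]
  constructor
  · intro h
    have hm := h m
    rwa [Polynomial.coeff_monomial, if_pos rfl] at hm
  · intro h m'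
    rw [Polynomial.coeff_monomial]
    split_ifs with hmm
    · subst hmm; exact h
    · exact zero_mem _

/-- **`I(c)` is a homogeneous ideal.** [folklore] -/
theorem isHomogeneousIdeal_fibreConeIdeal : IsHomogeneousIdeal (fibreConeIdeal c) := by
  intro g hg d
  -- lift every homogeneous component and read the kernel coefficientwise
  classical
  obtain ⟨G, rfl⟩ := MvPolynomial.map_surjective (residue O) residue_surjective g
  rw [← map_homogeneousComponent]
  rw [map_residue_mem_fibreConeIdeal_iff c (homogeneousComponent_isHomogeneous d G)]
  rw [fibreConeIdeal, RingHom.mem_ker, fibreConePolyMap_map_residue, Ideal.Quotient.eq_zero_iff_mem,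
    mem_reesMaxExt_iff_coeff] at hg
  have hd := hg d
  -- `poly (G(ct))` has degree-`d` coefficient `G_d(c)`
  have hsum : reesPolyMap c G = ∑ i ∈ Finset.range (G.totalDegree + 1), reesPolyMap c (homogeneousComponent i G) := by
    rw [← map_sum, sum_homogeneousComponent]
  rw [hsum, ← polyHom_apply, map_sum, Polynomial.finsetSum_coeff] at hd
  simp_rw [polyHom_apply, poly_reesPolyMap_of_isHomogeneous c (homogeneousComponent_isHomogeneous _ G),
    Polynomial.coeff_monomial, Finset.sum_ite_eq', Finset.mem_range] at hd
  split_ifs at hd with hlt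
  · exact hd
  · rw [homogeneousComponent_eq_zero _ _ (by omega), map_zero]
    exact zero_mem _

/-- `I(c)` consists of polynomials without constant term: **`I(c) ⊆ ker(eval 0) = (Y_1, …, Y_n)`**. [folklore] -/
theorem fibreConeIdeal_le_ker_eval_zero :
    fibreConeIdeal c ≤ RingHom.ker (eval (0 : Fin n → ResidueField O)) := by
  intro g hg
  obtain ⟨G, rfl⟩ := MvPolynomial.map_surjective (residue O) residue_surjective g
  rw [fibreConeIdeal, RingHom.mem_ker, fibreConePolyMap_map_residue, Ideal.Quotient.eq_zero_iff_mem] at hg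
  have h0 := coeff_mem_of_mem_reesMaxExt (𝔭) hg 0
  rw [← ReesRing.constCoeff_apply, constCoeff_reesPolyMap, pow_zero, Ideal.one_eq_top, Ideal.mul_top] at h0
  rw [RingHom.mem_ker, eval_map, ← coe_eval₂Hom, eval₂Hom_zero_apply, residue_eq_zero_iff]
  exact h0

/-- **The vertex pulls back to the origin: `fibreConePolyMap⁻¹(vertex) = ker(eval 0)`.** [folklore] -/
theorem comap_fibreConePolyMap_fibreConeVertex :
    (fibreConeVertex (𝔭)).comap (fibreConePolyMap c) = RingHom.ker (eval (0 : Fin n → ResidueField O)) := by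
  ext g
  obtain ⟨G, rfl⟩ := MvPolynomial.map_surjective (residue O) residue_surjective g
  rw [Ideal.mem_comap, fibreConePolyMap_map_residue, ← Ideal.mem_comap, comap_mk_fibreConeVertex,
    mem_reesVertex_iff, ← ReesRing.constCoeff_apply, constCoeff_reesPolyMap, RingHom.mem_ker, eval_map,
    ← coe_eval₂Hom, eval₂Hom_zero_apply, residue_eq_zero_iff]

/-- The vertex is the image of the origin: `vertex = (ker eval 0).map (fibreConePolyMap c)`. [folklore] -/
theorem map_fibreConePolyMap_ker_eval_zero :
    (RingHom.ker (eval (0 : Fin n → ResidueField O))).map (fibreConePolyMap c) = fibreConeVertex (𝔭) := by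
  rw [← comap_fibreConePolyMap_fibreConeVertex, Ideal.map_comap_of_surjective _ (fibreConePolyMap_surjective c)]

/-- [OURS · L1 W4.2] **`k[Y]/I(c) ≃ FibreCone 𝔭`**. NOT a statement of the manuscript. [folklore] -/
def fibreConeQuotEquiv : (MvPolynomial (Fin n) (ResidueField O) ⧸ fibreConeIdeal c) ≃+* FibreCone (𝔭) :=
  RingHom.quotientKerEquivOfSurjective (fibreConePolyMap_surjective c)

/-- `fibreConeQuotEquiv c (mk g) = fibreConePolyMap c g`. [folklore] -/
@[simp] theorem fibreConeQuotEquiv_mk (g : MvPolynomial (Fin n) (ResidueField O)) :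
    fibreConeQuotEquiv c (Ideal.Quotient.mk (fibreConeIdeal c) g) = fibreConePolyMap c g :=
  RingHom.quotientKerEquivOfSurjective_apply_mk (fibreConePolyMap_surjective c) g

/-- The vertex corresponds to the origin of `k[Y]/I(c)` under `fibreConeQuotEquiv`. [folklore] -/
theorem comap_fibreConeQuotEquiv_fibreConeVertex :
    (fibreConeVertex (𝔭)).comap (fibreConeQuotEquiv c).toRingHom =
      (RingHom.ker (eval (0 : Fin n → ResidueField O))).map (Ideal.Quotient.mk (fibreConeIdeal c)) := by
  rw [← comap_fibreConePolyMap_fibreConeVertex c]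
  have hcomp : fibreConePolyMap c = (fibreConeQuotEquiv c).toRingHom.comp (Ideal.Quotient.mk (fibreConeIdeal c)) :=
    RingHom.ext fun g => (fibreConeQuotEquiv_mk c g).symm
  rw [hcomp, ← Ideal.comap_comap, Ideal.map_comap_of_surjective _ Ideal.Quotient.mk_surjective]

/-- The origin `(Y)/I(c)` of `k[Y]/I(c)` is a maximal ideal. [folklore] -/
theorem isMaximal_map_ker_eval_zero_fibreConeIdeal :
    ((RingHom.ker (eval (0 : Fin n → ResidueField O))).map (Ideal.Quotient.mk (fibreConeIdeal c))).IsMaximal :=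
  isMaximal_map_ker_eval (fibreConeIdeal_le_ker_eval_zero c)

end Cone

/-! ## The Hilbert function of the vertex -/

section Hilbert

variable {O : Type u} [CommRing O] [IsLocalRing O] [IsNoetherianRing O] {n : ℕ} (c : Fin n → O)

local notation3 "𝔭" => Ideal.span (Set.range c)

/-- **`H⁽⁰⁾(FibreConeLocal 𝔭) = H(k[Y]/I(c))`**: the Hilbert function of the local ring of the fibre cone at its vertex is
the Hilbert function of the graded quotient `k[Y]/I(c)` (`hilbertFunQuot`), by `fibreConeQuotEquiv` and the cone's
`hilbertFun_localization_vertex_eq_hilbertFunQuot` (gen 2). [cite: CossartJannsenSaito2020, §2.2 (p. 27)] -/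
theorem hilbertFun_fibreConeLocal_eq_hilbertFunQuot :
    hilbertFun (FibreConeLocal (𝔭)) = hilbertFunQuot (ResidueField O) n (fibreConeIdeal c) := by
  haveI := isMaximal_map_ker_eval_zero_fibreConeIdeal c
  set I := fibreConeIdeal c
  set J : Ideal (MvPolynomial (Fin n) (ResidueField O) ⧸ I) :=
    (RingHom.ker (eval (0 : Fin n → ResidueField O))).map (Ideal.Quotient.mk I) with hJ
  set e := fibreConeQuotEquiv c
  -- `FibreConeLocal 𝔭` as a localization of `k[Y]/I(c)` at the origin, along `e`
  letI algQ : Algebra (MvPolynomial (Fin n) (ResidueField O) ⧸ I) (FibreConeLocal (𝔭)) :=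
    ((algebraMap (FibreCone (𝔭)) (FibreConeLocal (𝔭))).comp e.toRingHom).toAlgebra
  letI algK : Algebra (ResidueField O) (FibreConeLocal (𝔭)) :=
    ((algebraMap (FibreCone (𝔭)) (FibreConeLocal (𝔭))).comp (fibreConeResidueMap (𝔭))).toAlgebra
  haveI : IsScalarTower (ResidueField O) (MvPolynomial (Fin n) (ResidueField O) ⧸ I) (FibreConeLocal (𝔭)) :=
    IsScalarTower.of_algebraMap_eq fun a => by
      change ((algebraMap (FibreCone (𝔭)) (FibreConeLocal (𝔭))).comp (fibreConeResidueMap (𝔭))) a =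
        ((algebraMap (FibreCone (𝔭)) (FibreConeLocal (𝔭))).comp e.toRingHom)
          (Ideal.Quotient.mk I (C a))
      rw [RingHom.comp_apply, RingHom.comp_apply]
      congr 1
      change _ = e (Ideal.Quotient.mk I (C a))
      rw [fibreConeQuotEquiv_mk, fibreConePolyMap_C]
  -- the origin `J` is the pull-back of the vertex along `e`
  have hJ' : J = (fibreConeVertex (𝔭)).comap e.toRingHom := by
    rw [hJ, ← comap_fibreConeQuotEquiv_fibreConeVertex c]
  haveI : IsLocalization.AtPrime (FibreConeLocal (𝔭)) J := by
    have h := IsLocalization.isLocalization_of_base_ringEquiv (fibreConeVertex (𝔭)).primeCompl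
      (FibreConeLocal (𝔭)) e.symm
    have hM : (fibreConeVertex (𝔭)).primeCompl.map e.symm = J.primeCompl := by
      ext x
      rw [Submonoid.mem_map]
      constructor
      · rintro ⟨y, hy, rfl⟩ hx
        rw [hJ'] at hx
        exact hy (by simpa [Ideal.mem_comap] using hx)
      · intro hx
        refine ⟨e x, fun h' => hx ?_, e.symm_apply_apply x⟩
        rw [hJ']
        simpa [Ideal.mem_comap] using h'
    rw [hM] at h
    convert h using 1
    -- the algebra structures agree: `e.symm.symm = e`
    exact congrArg (fun f : (MvPolynomial (Fin n) (ResidueField O) ⧸ I) →+* FibreCone (𝔭) =>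
      ((algebraMap (FibreCone (𝔭)) (FibreConeLocal (𝔭))).comp f).toAlgebra) (by rfl)
  exact hilbertFun_localization_vertex_eq_hilbertFunQuot (isHomogeneousIdeal_fibreConeIdeal c) (FibreConeLocal (𝔭))

end Hilbert

end CampaignW42

end Summit.ResolutionOfSingularities.ResolutionOfSingularities.Theorems

end
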